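import Summits.CriticalPhenomena.CardyFormulaZ2.Theorems.CardySusyWardWeakHolomorphyReduction

/-!
# The `L¹` once-visit chirality law and the `L¹` Kirchhoff law are equivalent along admissible families

Line `Sketch` of the crux `CardySusyWard.WeakHolomorphy` (stmt-CriticalPhenomena-11292), lead c3 (infrastructure,
`--supports`).  The landed reduction file proves `stub_kirchhoffL1OfChiralityLaw` (law ⟹ Kirchhoff).  Here the converse,
`stub_onceChiralityLawL1OfKirchhoffL1` (Kirchhoff ⟹ law), by the same two ingredients: in the interior branch of the bulk
dichotomy the exact identity `F(NE) + F(SW) − F(NW) − F(SE) = s_p (κ_L Z_L + κ_R Z_R)` (`stub_kirchhoffIdentity`, `|s_p| = 1`)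
makes the two summands EQUAL in norm; in the other branch no corner above `K` is ever traversed, so the once-visit chiral
observables vanish as well (`onceChiralObs_eq_zero_of_vanish`: a vanishing spin-`1/3` dart phase sum means the cut orbit never
visits that corner, since each corner is visited at most once and carries a unimodular weight).  Consequently the open
registered statement `stub_onceChiralityLawL1` and the `L¹` Kirchhoff law of the dart observable are interchangeable as the
promoted item (`onceChiralityLawL1_iff_kirchhoffL1`).  References: Duminil-Copin–Smirnov arXiv:1109.1549 §8.3, Conj. 8.7;
Zhou arXiv:2409.03235 §4 eq. (102); crux workfile `Cruxes/WeakHolomorphy/Lines/Sketch.md`.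
-/

noncomputable section

namespace Summit.CriticalPhenomena.CardyFormulaZ2.Theorems.WeakHolomorphy.SplitBypass

open scoped BigOperators Topology
open Filter Set MeasureTheory Complex
open _root_.Literature.Probability.LatticeModels
open _root_.Literature.Probability.RandomPlanarGeometry (DobrushinDomain)
open _root_.Literature.Probability.Percolation (BondConfig bondPercolation half)
open _root_.Literature.Barriers.CriticalPhenomena (medialCornersAt medialVertexOf)
open Summit.CriticalPhenomena.CardyFormulaZ2.Theorems.ParafermionPrecompact.Negative (IsFamily)
open Summit.CriticalPhenomena.CardyFormulaZ2.Theorems.ParafermionFamiliesToSLESix.StripAnchored.S2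
  (dartW sixthPhase dartW_eq_single)
open _root_.Literature.Probability.LatticeModels.DiscreteDobrushin (startCorner exitTime isStartCorner_startCorner
  medialExploration_eq_explorationList isInnerFace_of_lt_exitTime)

/-! ## A vanishing dart weight means the corner is never visited -/

section Vanish

variable {E : DiscreteDobrushin}

/-- Along the exploration of admissible data each corner is visited at most once before the exit time and carries the
unimodular weight `sixthPhase (turnCount)`; so if the spin-`1/3` dart weight of the corner `r` vanishes, the cut orbit never
visits `r`. [folklore] -/
theorem not_visited_of_dartW_eq_zero (hE : E.IsZdAdmissible) (ω : BondConfig (Site 2)) {r : Site 2 × Fin 4}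
    (h : dartW (E.bcBondConfig ω) (startCorner hE) r (exitTime hE ω) = 0) :
    ∀ j < exitTime hE ω, cornerOrbit (E.bcBondConfig ω) (startCorner hE) j ≠ r := by
  intro j hj hjr
  have hc₀ := isStartCorner_startCorner hE
  have hlt : ∀ k < exitTime hE ω, E.IsInnerFace (cFace (cornerOrbit (E.bcBondConfig ω) (startCorner hE) k)) :=
    fun k hk => isInnerFace_of_lt_exitTime hE ω hk
  have uP : ∀ i < exitTime hE ω, cornerOrbit (E.bcBondConfig ω) (startCorner hE) i = r ↔ i = j := by
    intro i hi
    refine ⟨fun h' => ?_, fun h' => h' ▸ hjr⟩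
    by_contra hne
    rcases Nat.lt_or_gt_of_ne hne with hab | hab
    · exact cornerOrbit_ne hE hc₀ hab (fun k hk => hlt k (by omega)) (h'.trans hjr.symm)
    · exact cornerOrbit_ne hE hc₀ hab (fun k hk => hlt k (by omega)) (hjr.trans h'.symm)
  rw [dartW_eq_single hj uP] at h
  exact absurd h (by unfold sixthPhase; exact Complex.exp_ne_zero _)

/-- **No traversed corner, no once-visit.** If all four spin-`1/3` dart phase sums of the exploration path at the medial
vertex `p` vanish for every configuration (second branch of `stub_bulkDichotomy`), then both once-visit chiral observables
`Z_L(p)`, `Z_R(p)` of admissible data vanish. [folklore] -/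
theorem onceChiralObs_eq_zero_of_vanish (hE : E.IsZdAdmissible) {δ : ℝ} (hδ : δ ≠ 0) {p : Site 2 × Fin 2}
    (hvan : ∀ (k : Fin 4) (ω : BondConfig (Site 2)),
      Parafermion.dartPhaseSum (medialExploration E ω) δ (1 / 3) (medialCornersAt p.1 p.2 k) = 0) (b : Bool) :
    onceChiralObs E δ (1 / 3) (medialVertexOf p) b = 0 := by
  classical
  have hpath : ∀ ω, onceChiralPhase (medialExploration E ω) δ (1 / 3) (medialVertexOf p) b = 0 := by
    intro ω
    obtain ⟨x, i⟩ := p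
    obtain rfl | rfl : i = 0 ∨ i = 1 := by fin_cases i <;> simp
    · -- horizontal: arriving corners `(x, 3) = SW` and its partner `(x + e₀, 1) = NE`
      have h3 := hvan 3 ω
      have h1 := hvan 1 ω
      rw [medialExploration_eq_explorationList hE ω,
        dartPhaseSum_eq_dartW hδ _ (x, 3) (medialCornersAt x 0 3) rfl (by simp [medialCornersAt, cFace, faceAt, cornerOff])] at h3
      rw [medialExploration_eq_explorationList hE ω,
        dartPhaseSum_eq_dartW hδ _ (x + Pi.single 0 1, 1) (medialCornersAt x 0 1)
          (by simp [medialCornersAt]) (by simp [medialCornersAt, cFace, faceAt, cornerOff])] at h1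
      rw [show medialVertexOf (x, (0 : Fin 2)) = cTgt (x, 3) from rfl, medialExploration_eq_explorationList hE ω]
      exact onceChiralPhase_explorationList_never (not_visited_of_dartW_eq_zero hE ω h3)
        (not_visited_of_dartW_eq_zero hE ω h1) b
    · -- vertical: arriving corners `(x, 0) = SE` and its partner `(x + e₁, 2) = NW`
      have h2 := hvan 2 ω
      have h0 := hvan 0 ω
      rw [medialExploration_eq_explorationList hE ω,
        dartPhaseSum_eq_dartW hδ _ (x, 0) (medialCornersAt x 1 2) rfl (by simp [medialCornersAt, cFace, faceAt, cornerOff])] at h2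
      rw [medialExploration_eq_explorationList hE ω,
        dartPhaseSum_eq_dartW hδ _ (x + Pi.single 1 1, 2) (medialCornersAt x 1 0)
          (by simp [medialCornersAt]) (by simp [medialCornersAt, cFace, faceAt, cornerOff])] at h0
      rw [show medialVertexOf (x, (1 : Fin 2)) = cTgt (x, 0) from rfl, medialExploration_eq_explorationList hE ω]
      exact onceChiralPhase_explorationList_never (not_visited_of_dartW_eq_zero hE ω h2)
        (not_visited_of_dartW_eq_zero hE ω h0) b
  simp only [onceChiralObs, hpath, integral_zero]

end Vanish

/-! ## Kirchhoff ⟹ law, and the equivalence -/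

/-- **The `L¹` once-visit chirality law from the `L¹` Kirchhoff law** (converse of `stub_kirchhoffL1OfChiralityLaw`):
along every admissible family, over every compact `K ⊂ Ω`, the two `L¹` sums agree eventually — interior branch: the exact
identity `stub_kirchhoffIdentity` with `|s_p| = 1`; other branch: both summands vanish. [folklore] -/
theorem stub_onceChiralityLawL1OfKirchhoffL1 : (∀ (D : DobrushinDomain) (Λ : ℝ → DiscreteDobrushin), IsFamily D Λ → ∀ (K : Set ℂ), IsCompact K → K ⊆ D.carrier → ∀ ε > (0:ℝ), ∀ᶠ δ in 𝓝[>] (0:ℝ), ∀ S : Finset (Site 2 × Fin 2), (∀ p ∈ S, medialPoint δ (medialVertexOf p) ∈ K) → ∑ p ∈ S, ‖bondDartObservable (Λ δ) δ (1 / 3) (medialCornersAt p.1 p.2 1) + bondDartObservable (Λ δ) δ (1 / 3) (medialCornersAt p.1 p.2 3) - bondDartObservable (Λ δ) δ (1 / 3) (medialCornersAt p.1 p.2 0) - bondDartObservable (Λ δ) δ (1 / 3) (medialCornersAt p.1 p.2 2)‖ ≤ ε * δ ^ (-(5:ℝ) / 3)) → ∀ (D : DobrushinDomain) (Λ : ℝ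 → DiscreteDobrushin), IsFamily D Λ → ∀ (K : Set ℂ), IsCompact K → K ⊆ D.carrier → ∀ ε > (0:ℝ), ∀ᶠ δ in 𝓝[>] (0:ℝ), ∀ S : Finset (Site 2 × Fin 2), (∀ p ∈ S, medialPoint δ (medialVertexOf p) ∈ K) → ∑ p ∈ S, ‖onceKappa true * onceChiralObs (Λ δ) δ (1 / 3) (medialVertexOf p) true + onceKappa false * onceChiralObs (Λ δ) δ (1 / 3) (medialVertexOf p) false‖ ≤ ε * δ ^ (-(5:ℝ) / 3) := by
  intro hK1 D Λ hΛ K hK hKD ε hε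
  have hadm := hΛ.2.2.2.2.2
  filter_upwards [hK1 D Λ hΛ K hK hKD ε hε, stub_bulkDichotomy D Λ hΛ K hK hKD, hadm, self_mem_nhdsWithin]
    with δ hKδ hdich hA hδpos S hS
  have hδ0 : (0:ℝ) < δ := hδpos
  refine le_trans (Finset.sum_le_sum fun p hp => ?_) (hKδ S hS)
  rcases hdich with hint | hvan
  · have hHF : HoleFree {f : Site 2 | (Λ δ).IsInnerFace f} :=
      holeFree_innerFaces D.toJordanDomain (hΛ.1 δ) (by rw [hΛ.2.1 δ]; exact hδ0)
    have h := stub_kirchhoffIdentity (Λ δ) hA hHF p (hint p (hS p hp)) δ hδ0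
    rw [h, norm_mul]
    have hs : ‖(if p.2 = 0 then (1 : ℂ) else -1)‖ = 1 := by split_ifs <;> simp
    rw [hs, one_mul]
  · rw [onceChiralObs_eq_zero_of_vanish hA hδ0.ne' (hvan p (hS p hp)) true,
      onceChiralObs_eq_zero_of_vanish hA hδ0.ne' (hvan p (hS p hp)) false]
    simp only [mul_zero, add_zero, norm_zero]
    exact norm_nonneg _

/-- **Equivalence of the two `L¹` laws along admissible families**: the `L¹` once-visit chirality law (registered open stub
`stub_onceChiralityLawL1` of the line) holds iff the `L¹` Kirchhoff law of the spin-`1/3` dart observable holds.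
[cite: DuminilCopinSmirnov2012Lattice, Conjecture 8.7] -/
theorem onceChiralityLawL1_iff_kirchhoffL1 :
    (∀ (D : DobrushinDomain) (Λ : ℝ → DiscreteDobrushin), IsFamily D Λ →
      ∀ (K : Set ℂ), IsCompact K → K ⊆ D.carrier → ∀ ε > (0:ℝ), ∀ᶠ δ in 𝓝[>] (0:ℝ),
        ∀ S : Finset (Site 2 × Fin 2), (∀ p ∈ S, medialPoint δ (medialVertexOf p) ∈ K) →
          ∑ p ∈ S, ‖onceKappa true * onceChiralObs (Λ δ) δ (1 / 3) (medialVertexOf p) true +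
              onceKappa false * onceChiralObs (Λ δ) δ (1 / 3) (medialVertexOf p) false‖ ≤
            ε * δ ^ (-(5:ℝ) / 3)) ↔
    (∀ (D : DobrushinDomain) (Λ : ℝ → DiscreteDobrushin), IsFamily D Λ →
      ∀ (K : Set ℂ), IsCompact K → K ⊆ D.carrier → ∀ ε > (0:ℝ), ∀ᶠ δ in 𝓝[>] (0:ℝ),
        ∀ S : Finset (Site 2 × Fin 2), (∀ p ∈ S, medialPoint δ (medialVertexOf p) ∈ K) →
          ∑ p ∈ S, ‖bondDartObservable (Λ δ) δ (1 / 3) (medialCornersAt p.1 p.2 1) +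
              bondDartObservable (Λ δ) δ (1 / 3) (medialCornersAt p.1 p.2 3) -
              bondDartObservable (Λ δ) δ (1 / 3) (medialCornersAt p.1 p.2 0) -
              bondDartObservable (Λ δ) δ (1 / 3) (medialCornersAt p.1 p.2 2)‖ ≤ ε * δ ^ (-(5:ℝ) / 3)) :=
  ⟨stub_kirchhoffL1OfChiralityLaw, stub_onceChiralityLawL1OfKirchhoffL1⟩

end Summit.CriticalPhenomena.CardyFormulaZ2.Theorems.WeakHolomorphy.SplitBypass

end
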